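import Mathlib
import Summits.HubbardSuperconductivity.HubbardSuperconductivity.Theses.KLProgramme
import Summits.HubbardSuperconductivity.HubbardSuperconductivity.Theorems.KLProgrammeH10RungCompactBoxTruncated
import Summits.HubbardSuperconductivity.HubbardSuperconductivity.Theorems.KLProgrammeH10RungCompactBoxMu
import HarnessLib

/-!
# Route KLProgramme — support item R0′ `H10RungCompactBox` (BC5 FIRST rung of crux K1), PROVED

`H10RungCompactBox_proof : Summit.HubbardSuperconductivity.HubbardSuperconductivity.Theses.KLProgramme.H10RungCompactBox`
(item stmt-HubbardSuperconductivity-20034; = stub `stub_H10_rung_compact` of the registered birth skeleton of crux K1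
`H10TwoPointLimit`, stmt-HubbardSuperconductivity-19938): for every `B > 0` there is `U₀ = U₀(B) > 0` such that for
all dopings `δ ∈ [0.10, 0.35]`, couplings `0 < U ≤ U₀` and inverse temperatures `0 < β ≤ B`, the finite-volume
thermal two-point functions of the square-lattice Hubbard torus at the free-band chemical potential `μ(1 - δ)`
converge as `L → ∞`.

Proof: the single-scale corner of the tree (`HubbardTorusTwoPointSmallCoupling`: bare perturbation theory with
determinant/tree bounds converges uniformly in the volume for `|U| < r(β, μ) ∝ (β C(β, μ) S)⁻¹`) made UNIFORM on
the compact box `(β, μ) ∈ (0, B] × [-4, 5]` (`h10rung_twoPoint_limit_box`, helpers 1–3: the free propagator's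
decay constant is ONE constant on compact `(τ, β, μ)`-boxes because the symbol `e^{-τE} f_β(E)` is jointly
`C^∞` and the elliptic-iterate/compactness argument runs with a three-dimensional parameter), and the a-priori
window `μ(1 - δ) ∈ [-4, 5]` (`h10rung_chemicalPotential_mem_Icc`, helper 4). REF-CHECK §13 FINDING-1 option
(α); DECOMP v6 §8(f). Standard axioms; no definition. What this is NOT: the uncapped βU-corner (second rung
`H10RungBetaUCorner`) or K1 itself (`β ≤ e^{a/U}`) — those need the multiscale analysis.
-/

noncomputable section

-- the tree's namespace `Summit.<Summit>.<Problem>.Theorems` repeats the summit name by design (D-0017)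
set_option linter.dupNamespace false

open Filter Topology Set
open Literature.MathematicalPhysics.QuantumLattice

namespace Summit.HubbardSuperconductivity.HubbardSuperconductivity.Theorems

/-- **R0′ `H10RungCompactBox` (route KLProgramme, item stmt-HubbardSuperconductivity-20034): the compact-box
corner of crux K1 `H10TwoPointLimit`.** For every `B > 0` there is `U₀ > 0` such that for all
`δ ∈ [0.10, 0.35]`, `0 < U ≤ U₀`, `0 < β ≤ B`, all sites `x, y ∈ ℤ²` and spins, the thermal two-point function
`⟨c†_{xσ} c_{yσ'}⟩_{β, L, U, μ(1-δ)}` of `hubbardTorusWith 2 L 1 U μ(1-δ)` has a limit as `L → ∞`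
(Benfatto–Giuliani–Mastropietro 2006 §2.2–2.3 at a single scale, with the radius made uniform on the box). -/
theorem H10RungCompactBox_proof :
    Summit.HubbardSuperconductivity.HubbardSuperconductivity.Theses.KLProgramme.H10RungCompactBox := by
  intro B hB
  obtain ⟨r, hr, h⟩ := h10rung_twoPoint_limit_box B (-4) 5
  refine ⟨r / 2, by positivity, fun δ hδ U β hU hUle hβ hβB x y σ σ' => ?_⟩
  have hn : (0 : ℝ) < 1 - δ := by linarith [hδ.2]
  have hn2 : (1 : ℝ) - δ ≤ 2 := by linarith [hδ.1]
  have hμ := h10rung_chemicalPotential_mem_Icc hn hn2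
  have hUr : |U| < r := by rw [abs_of_pos hU]; linarith
  exact h β ⟨hβ, hβB⟩ _ hμ U hUr x y σ σ'

end Summit.HubbardSuperconductivity.HubbardSuperconductivity.Theorems

end
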